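import Summits.Ventures.QEC.Census.CertCheckBZBridge
import HarnessLib

/-!
# Word lemmas for the in-kernel meet-in-the-middle replay of Brouwer–Zimmermann matrices:
# pigeonhole over residue-class column groups and masked equality from a masked XOR
# (census/search-9's MITM soundness proof, sub-lemmas L1 and L2)

Pure word lemmas in the vocabulary of the CSS distance-certificate checker (`popc` of `Census/CertBits.lean`,
`maskOf` of `Census/CertCheckBZ.lean`, `bitSet` of `Census/CertBZWords.lean`), named by qec-search-9
(2026-08-26T23:57:48Z, lemmas L1 and L2 of the soundness proof of the meet-in-the-middle replay of the `bz_aut`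
matrices of the `[[144,12,12]]` certificate; writer qec-type-07 gen 3 per director-qec R10, co-listed qec-type-11):

* `exists_group_and_eq_zero` (L1, PIGEONHOLE over residue-class column groups) — a word with fewer than `s` set
  bits below `n` misses one of the `s` column groups `{q < n : q ≡ g (mod s)}` entirely:
  `∃ g < s, c &&& maskOf [q < n | q % s = g] = 0`;
* `and_eq_and_of_xor_and_eq_zero` (L2) — if `(a ⊕ b) ∧ M = 0` then `a ∧ M = b ∧ M` (two words that agree on a
  mask after XOR agree on the mask);
* helpers `testBit_and_maskOf_group` (bits of a word restricted to a group) and `mod_ne_of_and_maskOf_group_eq_zero`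
  (the converse reading used by the replay: a vanishing group restriction means no set bit in that class);
* (append 2026-08-27) `exists_lt_and_mask_eq_zero` — the same pigeonhole for an ARBITRARY indexed family of column-group
  masks `A g`, `g < s`, in exactly the shape the replay's `groupsOK` checks (each mask avoids the information-set mask
  `M`, lies below `2^n`, distinct masks are disjoint): `popc n (c &&& ((2^n − 1) ^^^ M)) < s ⇒ ∃ g < s, c &&& A g = 0`
  (the hypothesis is the redundancy weight of `CertSystematicWeight.popc_eq_length_add_popc_and_red`), with the
  helper `and_compl_eq_self_of_and_eq_zero`.

All statements are over `ℕ` words; proofs are bit extensionality (`Nat.eq_of_testBit_eq`, `Nat.testBit_and`,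
`Nat.testBit_xor`, `testBit_maskOf`) and the pigeonhole principle on the bit set `bitSet n c` mapped to residues
`mod s`. No definitions, no distance value asserted; tier KERNEL (axioms standard).
-/

namespace Summit.Ventures.QEC.Census

open Finset

/-- Bits of a word restricted to the residue-class group `g` modulo `s` (columns below `n`): bit `i` of
`c &&& maskOf [q < n | q % s = g]` is set iff `i < n`, `i % s = g` and bit `i` of `c` is set. -/
theorem testBit_and_maskOf_group (n s g c i : ℕ) :
    (c &&& maskOf ((List.range n).filter fun q => q % s == g)).testBit i =
      (c.testBit i && decide (i < n ∧ i % s = g)) := by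
  rw [Nat.testBit_and, testBit_maskOf]
  congr 1
  by_cases h : i < n ∧ i % s = g
  · rw [decide_eq_true h, decide_eq_true]
    exact List.mem_filter.2 ⟨List.mem_range.2 h.1, by simp [h.2]⟩
  · rw [decide_eq_false h, decide_eq_false]
    intro hm
    obtain ⟨h1, h2⟩ := List.mem_filter.1 hm
    exact h ⟨List.mem_range.1 h1, by simpa using h2⟩

/-- **L1 (pigeonhole over residue-class column groups).** If a word `c` has fewer than `s` set bits below `n`
(`popc n c < s`, `0 < s`), then for some residue `g < s` the word has NO set bit in the column group
`{q < n : q % s = g}`: `c &&& maskOf ((List.range n).filter (· % s == g)) = 0`. (The set bits below `n` occupy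
fewer than `s` residue classes modulo `s`.) Used by the MITM replay: a redundancy part of weight `< s` vanishes
on one of `s` column groups, where the two halves of a collision must then agree exactly. -/
theorem exists_group_and_eq_zero (n s c : ℕ) (hs : 0 < s) (hc : popc n c < s) :
    ∃ g, g < s ∧ c &&& maskOf ((List.range n).filter fun q => q % s == g) = 0 := by
  classical
  -- the residues of the set bits of `c` below `n`
  set R : Finset ℕ := (bitSet n c).image (fun i : Fin n => (i : ℕ) % s) with hR
  have hcard : R.card < (Finset.range s).card := by
    calc R.card ≤ (bitSet n c).card := Finset.card_image_le
      _ = popc n c := card_bitSet n c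
      _ < s := hc
      _ = (Finset.range s).card := (Finset.card_range s).symm
  obtain ⟨g, hg, hgR⟩ := Finset.exists_mem_notMem_of_card_lt_card hcard
  have hgs : g % s = g := Nat.mod_eq_of_lt (Finset.mem_range.1 hg)
  refine ⟨g % s, Nat.mod_lt g hs, ?_⟩
  rw [hgs]
  refine Nat.eq_of_testBit_eq fun i => ?_
  rw [testBit_and_maskOf_group, Nat.zero_testBit, Bool.and_eq_false_iff]
  by_cases hci : c.testBit i = true
  · right
    rw [decide_eq_false_iff_not]
    rintro ⟨hin, hig⟩
    exact hgR (Finset.mem_image.2 ⟨⟨i, hin⟩, mem_bitSet.2 hci, hig⟩)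
  · left
    simpa using hci

/-- Reading L1's conclusion back: if `c &&& maskOf [q < n | q % s = g] = 0` then no set bit `i < n` of `c` has
`i % s = g`. -/
theorem mod_ne_of_and_maskOf_group_eq_zero {n s g c : ℕ}
    (h : c &&& maskOf ((List.range n).filter fun q => q % s == g) = 0) {i : ℕ} (hi : i < n)
    (hci : c.testBit i = true) : i % s ≠ g := by
  intro hig
  have := congrArg (fun w => Nat.testBit w i) h
  simp only [testBit_and_maskOf_group, Nat.zero_testBit, hci, Bool.true_and, decide_eq_false_iff_not] at this
  exact this ⟨hi, hig⟩

/-- **L2 (masked equality from a vanishing masked XOR).** If `(a ^^^ b) &&& M = 0` then `a &&& M = b &&& M`: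
two words whose XOR vanishes on the mask `M` agree on `M`. (Bit extensionality.) Used by the MITM replay: a
collision on a column group is an exact equality of the two group restrictions. -/
theorem and_eq_and_of_xor_and_eq_zero {a b M : ℕ} (h : (a ^^^ b) &&& M = 0) : a &&& M = b &&& M := by
  refine Nat.eq_of_testBit_eq fun i => ?_
  have hi := congrArg (fun w => Nat.testBit w i) h
  simp only [Nat.testBit_and, Nat.testBit_xor, Nat.zero_testBit] at hi
  rw [Nat.testBit_and, Nat.testBit_and]
  revert hi
  cases a.testBit i <;> cases b.testBit i <;> cases M.testBit i <;> simp

/-- The converse of L2 (so the replay may test either form): equal restrictions have vanishing masked XOR. -/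
theorem xor_and_eq_zero_of_and_eq_and {a b M : ℕ} (h : a &&& M = b &&& M) : (a ^^^ b) &&& M = 0 := by
  refine Nat.eq_of_testBit_eq fun i => ?_
  have hi := congrArg (fun w => Nat.testBit w i) h
  simp only [Nat.testBit_and] at hi
  rw [Nat.testBit_and, Nat.testBit_xor, Nat.zero_testBit]
  revert hi
  cases a.testBit i <;> cases b.testBit i <;> cases M.testBit i <;> simp

/-! ## Pigeonhole over pairwise-disjoint column-group masks (the `groupsOK` shape of the MITM replay) -/

/-- A mask that avoids `M` and lies below `2^n` sits inside the complement `(2^n − 1) ^^^ M` of `M` (below `n`):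
`A &&& ((2^n − 1) ^^^ M) = A`. -/
theorem and_compl_eq_self_of_and_eq_zero {n A M : ℕ} (hAM : A &&& M = 0) (hA : A < 2 ^ n) :
    A &&& ((2 ^ n - 1) ^^^ M) = A := by
  refine Nat.eq_of_testBit_eq fun i => ?_
  have hi := congrArg (fun w => Nat.testBit w i) hAM
  simp only [Nat.testBit_and, Nat.zero_testBit, Bool.and_eq_false_iff] at hi
  rw [Nat.testBit_and, Nat.testBit_xor, Nat.testBit_two_pow_sub_one]
  by_cases hin : i < n
  · rcases hi with h | h
    · simp [h]
    · simp [h, hin]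
  · have : A.testBit i = false := by
      apply Nat.testBit_eq_false_of_lt
      exact lt_of_lt_of_le hA (Nat.pow_le_pow_right (by norm_num) (not_lt.1 hin))
    simp [this]

/-- **Pigeonhole over pairwise-disjoint column groups** (the shape checked by `groupsOK` of the MITM replay: every
group mask `A g`, `g < s`, avoids the information-set mask `M`, lies below `2^n`, and distinct groups are disjoint).
If a word `c` has fewer than `s` set bits below `n` OUTSIDE `M` — `popc n (c &&& ((2^n − 1) ^^^ M)) < s`, the
redundancy weight of `CertSystematicWeight.popc_eq_length_add_popc_and_red` — then `c` vanishes on some group: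
`∃ g < s, c &&& A g = 0`. (Each hit group holds a bit of `c` outside `M`; the groups are disjoint.) -/
theorem exists_lt_and_mask_eq_zero (n s c M : ℕ) (A : ℕ → ℕ) (hAM : ∀ g, g < s → A g &&& M = 0)
    (hAn : ∀ g, g < s → A g < 2 ^ n) (hdisj : ∀ g g', g < s → g' < s → g ≠ g' → A g &&& A g' = 0)
    (hc : popc n (c &&& ((2 ^ n - 1) ^^^ M)) < s) : ∃ g, g < s ∧ c &&& A g = 0 := by
  classical
  by_contra hne
  have hne' : ∀ g, g < s → c &&& A g ≠ 0 := fun g hg h => hne ⟨g, hg, h⟩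
  -- each hit group carries a bit of `c` outside `M` (below `n`), and the groups' bit sets are disjoint
  have hsub : (Finset.range s).biUnion (fun g => bitSet n (c &&& A g)) ⊆ bitSet n (c &&& ((2 ^ n - 1) ^^^ M)) := by
    intro i hi
    obtain ⟨g, hg, hig⟩ := Finset.mem_biUnion.1 hi
    have hg' := Finset.mem_range.1 hg
    have key : c &&& A g = (c &&& ((2 ^ n - 1) ^^^ M)) &&& A g := by
      rw [Nat.and_assoc, Nat.land_comm ((2 ^ n - 1) ^^^ M) (A g),
        and_compl_eq_self_of_and_eq_zero (hAM g hg') (hAn g hg')]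
    rw [key, bitSet_and] at hig
    exact (Finset.mem_inter.1 hig).1
  have hdisj' : ((Finset.range s : Finset ℕ) : Set ℕ).PairwiseDisjoint fun g => bitSet n (c &&& A g) := by
    intro g hg g' hg' hgg'
    rw [Function.onFun, Finset.disjoint_iff_inter_eq_empty, ← bitSet_and]
    have : c &&& A g &&& (c &&& A g') = c &&& (A g &&& A g') := by
      refine Nat.eq_of_testBit_eq fun i => ?_
      simp only [Nat.testBit_and]
      cases c.testBit i <;> cases (A g).testBit i <;> cases (A g').testBit i <;> rfl
    rw [this, hdisj g g' (Finset.mem_range.1 (Finset.mem_coe.1 hg)) (Finset.mem_range.1 (Finset.mem_coe.1 hg')) hgg',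
      Nat.and_zero, bitSet_zero]
  have hcard := Finset.card_le_card hsub
  rw [Finset.card_biUnion hdisj', card_bitSet] at hcard
  -- every summand is `≥ 1`
  have hsum : s ≤ ∑ g ∈ Finset.range s, (bitSet n (c &&& A g)).card := by
    calc s = ∑ g ∈ Finset.range s, 1 := by simp
      _ ≤ ∑ g ∈ Finset.range s, (bitSet n (c &&& A g)).card :=
          Finset.sum_le_sum fun g hg => by
            rw [card_bitSet]
            have hg' := Finset.mem_range.1 hg
            exact popc_pos n (hne' g hg') (lt_of_le_of_lt Nat.and_le_right (hAn g hg'))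
  omega

end Summit.Ventures.QEC.Census
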